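import Mathlib
import HarnessLib
import HarnessLib.Audit
import Summits.Ventures.CertifiedManyBodySolver.HubbardAlg.MbsolverRungLeaves

/-!
Route: M3PrimeEdgeSplit

# Route M3PrimeEdgeSplit — M3′ at (8, 7/8, 0) as a declared edge split — certified upper ≤ −3/4 and
certified lower ≥ −4/5 decide the split leaf (lower ∧ upper; window width exactly 1/20)

It suffices to show X = UpperEdge_le_m3o4 ∧ LowerEdge_ge_m4o5: the thermodynamic-limit ground-state
energy density
e = `energyDensityTT' 1 0 8 (7/8)` of the square-lattice Hubbard model at (U, n, t′) = (8, 7/8, 0)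
satisfies a CERTIFIED
UPPER row `e ≤ hi` with `hi ≤ −3/4` AND a CERTIFIED LOWER row `lo ≤ e` with `lo ≥ −4/5`. The pair IS
the declared-split rung leaf
`MbsolverRungLeaves.M3Split_tp0_M3prime` (:= M3Lower_tp0_ge_m4o5 ∧ M3Upper_tp0_le_m3o4, tree l.281);
its window [−4/5, −3/4] has width
exactly 1/20 = `M3Width`, so it implies the ∃-window leaf `M3Window_tp0_M3prime` — that leaf is
classically inhabited (density of ℚ),
bookkeeping only; no closure of a window leaf is rung progress. The lower half is BY NAME the
registered T1 PROGRAMME leaf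
`MbsolverRungLeaves.M3Lower_tp0_ge_m4o5`; the upper half is verbatim the threshold leaf
`M3Upper_tp0_le_m3o4` (l.275). D-0145 LINES
registration for the sr-mbsolver cell (director-hubbard g11, LEAD gen-27 (E5)); no idea card (crew
rung route). HONEST FRAMING: first
certified bounds; not a superconductivity verdict; no dated object reaches either edge today (cell
of record [#529, #580] =
[−0.8295699476, −0.7249973335], width 0.1045726140 = ×2.09 of M3′ since CERTIFIED #580 / MOVE 176,
2026-08-28T16:53Z — refreshed 2026-08-29 by the
lines seat g7; was [#529, #550] ×2.14); rungs are rungs.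
ATTACKED / RESIDUAL (D-0033 header; J S1 supplement sha16 8bbe8e6a6aa35ad9, ROUND 1 PASS · FRONTIER,
replayed 2026-08-28T06:47:26Z; director-hubbard ENDORSE REQUESTS l.27353/l.27442): ATTACKED = the
UPPER edge `UpperEdge_le_m3o4` (stmt-Ventures-21720) — producers var / BD-STRIP / plaquette-seam
S3–S5 (best certified #580 S5-final column-seam `COL3ALTR_balW4D1400x0` hi = −25508575947185/2⁴⁵ =
−0.7249973, gap 0.0250027 — node `Certificates.m3_tp0_upper_colseam_COL3ALTR_balW4D1400x0_of`, aside
`M3UpperS5ColseamW4` (stmt-Ventures-22798); supersedes #550 S4 plaquette-seam v2 hi =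
−25421994941063/2⁴⁵ = −0.7225366 (gap 0.0274634, aside `M3UpperS4PlaqseamW4`) by 0.0024608; producer
verdict 2026-08-29 (var-1 DESIGN-ASK l.30374, FLOAT/EST): no object certifying ≤ −0.747 is in reach
of this campaign — W = 8 dressed ≈ −0.72…−0.74 at D → ∞, −3/4 needs W ≈ 12–16 dressed or a new
inter-strip layer; in-scope rung of the attacked conjunct `M3Upper_tp0_floor354_of`; S-case
`M3Upper_tp0_le_m3o4` open); RESIDUAL = the LOWER edge `LowerEdge_ge_m4o5` (stmt-Ventures-21721) =
complement conjunct in the D-0033 sense only — it stays an item and the closer-list rung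
`M3Lower_tp0_ge_m4o5` (hub-lb; best certified #529 lo = −0.8295699, gap 0.0295699); no difficulty
claim either way. JUDGED AGAINST `MbsolverRungLeaves.M3Split_tp0_M3prime`: `closes` RE-POINTED there
at rev 8 (2026-08-28T06:34Z, alt_closers rung M3w); route OPEN since the round-1 replay.
Lean: `(∃ hi : ℚ, hi ≤ (-3/4 : ℚ) ∧ Summit.Ventures.CertifiedManyBodySolver.M3EnergyUpperRow 0 hi) ∧
Summit.Ventures.CertifiedManyBodySolver.MbsolverRungLeaves.M3Lower_tp0_ge_m4o5`

## Assembly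
Pure logic on the slots, rendered as the deciding theorem `closes (h₂ : UpperEdge_le_m3o4) (h₃ :
LowerEdge_ge_m4o5) :
MbsolverRungLeaves.M3Split_tp0_M3prime := ⟨h₃, h₂⟩` (the split leaf is literally lower ∧ upper;
`LowerEdge_ge_m4o5` is
`M3Lower_tp0_ge_m4o5` by name and `UpperEdge_le_m3o4` is the body of `M3Upper_tp0_le_m3o4`). The
Assembly item below is the older
implication to the ∃-window leaf as a Prop (true by `M3EnergyRow_iff` + `linarith` on hi ≤ −3/4,
−4/5 ≤ lo; exempt, not the deciding
theorem); the deciding theorem is `closes` in glue.lean.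

CLOSES_TARGET: closes rung M3w of Ventures/CertifiedManyBodySolver: Summit.Ventures.CertifiedManyBodySolver.MbsolverRungLeaves.M3Split_tp0_M3prime (D-0061; not the summit Statement) — the deciding theorem of this route concludes that registered leaf (Ventures/CertifiedManyBodySolver: no summit Statement) (class rung: servable and labelled, never counted as concluding the summit Statement).

Rationale: WHY THIS LINE. M3′(a) of the venture Statement asks for a certified two-sided e₀ window of width ≤
0.05·t at (8, 7/8, 0); in Lean the only
non-vacuous form of that sentence is a PAIR OF DECLARED THRESHOLDS (a window-existence `∃ lo hi : ℚ,
…` over a fixed real is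
classically inhabited by density of ℚ — venture Statement D-8; kernel witness in this seat's folder,
see CHEAPEST FALSIFIER), so the
route DECLARES the split and makes each edge a crux. The split [−4/5, −3/4] is chosen (i) to contain
the float consensus
e_float = −0.767 ± 0.004 (ZhengEtAl2017 multi-method; LeBlancEtAl2015 −0.75…−0.77 by method) with
margins 0.033 below / 0.017
above, (ii) to REUSE the programme's own registered lower yardstick −4/5 (T1 leaf
`M3Lower_tp0_ge_m4o5`, 'end of the deep-patch
ladder'), and (iii) to put the larger share of the remaining distance on the UPPER side, where
variational states (open strips of
width w lose ≈ 0.165/w per site: w = 4 −0.726, w = 8 −0.742…−0.746 FLOAT, var TILING-CEILING v0.3)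
have a priced path, whereas
the LOWER side faces the SOS relaxation wall (degree-4 SOS misses second-order perturbation theory,
Hastings2022; printed K = 7
bootstrap −0.867 at this point, Han2020Bootstrap; in-house #529 −0.8296). Imported: Ruelle's
open-cluster transport and the
cell's dressed-box-tiling limit (`Upper.DressedBoxTiling.energyDensityTT'_le_of_tiling_rat`,
Ruelle1969 §3.3) on the upper side;
translation-invariant moment/SOS relaxations with exact rational dual certificates
(`ThermodynamicLimit.energyDensityTT'_ge_of_window_certificate_d4`,
Han2020Bootstrap §3, WangEtAl2024) on the lower side. What no prior route does:
R2cOpenStripTangentLine decides the −18/25 UPPER leaf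
only; nothing typed the M3′ window as a decided pair.

RANKED CRUXES. #2 UpperEdge_le_m3o4 (crux) — some certified thermodynamic-limit UPPER row at (8,
7/8, 0) at or below −3/4: ∃ hi ∈ ℚ, hi ≤ −3/4 ∧ e(1,0,8,7/8) ≤ hi (equivalently e ≤ −3/4). Producers
(LEAD (E5) U-1…U-5): S3 bd-strip-seam W = 4 (−0.7165560356, cert), S4 plaquette-seam W = 4
(−0.7225365534, CERTIFIED #550), S5 column-seam W = 4 (−0.7249973335, CERTIFIED #580 2026-08-28,
aside M3UpperS5ColseamW4), S1 bd-strip W = 6 column (W6-A exact-cert cell −835760963/1.2·10⁹ =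
−0.6964675 as aside M3UpperS1BdstripW6; producer data 2026-08-29, FLOAT/EST, l.31010: no banked W =
6 cell ≤ −0.716, dressed class ≈ −0.7205 ± 0.002), (U1) W = 8 dressed strips (≈ −0.71…−0.73 at
bookable cuts, −0.72…−0.74 at D → ∞ [EST]; var-1 DESIGN-ASK l.30374: «no object certifying ≤ −0.747
in reach of this campaign»), E1 depth-2 dressed quasi-free, D8/D78 plane programme — none reaches
−3/4; the object that does is a w ≥ 12 open strip / 2-D seam-correlated state at certifiable bond
dimension. [difficulty: XL] (why it might fail: −3/4 sits only 0.017 above the float TL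
(−0.767±0.004, ZhengEtAl2017); open strips lose ≈0.165/w per site (w=8: −0.744 FLOAT), so w ≥ 12–16
or 2-D seam-correlated states at certifiable bond dimension are needed; false outright if
e(1,0,8,7/8) > −0.75.) [ZhengEtAl2017, LeBlancEtAl2015, QinEtAl2020, Ruelle1969]
#3 LowerEdge_ge_m4o5 (crux) — some certified thermodynamic-limit LOWER row at (8, 7/8, 0) at or
above −4/5: ∃ lo ∈ ℚ, −4/5 ≤ lo ∧ lo ≤ e(1,0,8,7/8) — BY NAME the registered T1 PROGRAMME leaf
`MbsolverRungLeaves.M3Lower_tp0_ge_m4o5` (alt-closer rung T1; any theorem proving that leaf closes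
this item by `exact`). Producers (LEAD (E5) / seat A l.26029 L-1, L-2, L-6): JOINT MENU ⊕ rider96 ⊕
PLQ3s800 first-order dual editions (expected +2.5e-4…+3.5e-3 over #529), MENU-XL (conditional),
n-tangent derived lowers; needs a T2-class footprint to pass −0.80. [difficulty: XL] (why it might
fail: needs +0.0296 over the lower of record #529 (−0.8296, 1.7M-multiplier FO dual); every +0.01
costs ≈×10 in relaxation size, degree-4 SOS misses 2nd-order PT (Hastings2022) and footprint-(≤3,5)
windows cap at −0.7826 (cal-3 H5); false if e < −0.8.) [Han2020Bootstrap, Hastings2022,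
WangEtAl2024, ZhengEtAl2017]

TWO-LAYER PLAN. Foreseen glued splits (nothing filed now; BC3 birth skeletons registered with the
cruxes): UpperEdge_le_m3o4 ⇐ StripFamily_le_m3o4 →
TilingTransport → UpperEdge_le_m3o4, where StripFamily_le_m3o4 = "a certified all-k OPEN a × (k·b)
family at filling exactly 7/8
(8N = 7ab) with k-free endpoint (E+Δ)/(ab) ≤ −3/4" (the shape of CERTIFIED #354/#524's claim nodes
`cert_dbt299…_allk`) and
TilingTransport = `Upper.DressedBoxTiling.energyDensityTT'_le_of_tiling_rat` (provable now; R2c's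
`hexit`). LowerEdge_ge_m4o5 ⇐
TorusFloor_m4o5 → FloorTransport → LowerEdge_ge_m4o5, where TorusFloor_m4o5 = "∃ μ, eventually in L
the (7/8)-sector ground energy
of the L×L torus per site is ≥ −4/5 + μ·(rectN/L² − 7/8)" (what every translation-invariant
SOS/moment certificate proves uniformly in
L) and FloorTransport = `ThermodynamicLimit.energyDensityTT'_ge_of_eventually_ge_torus` (provable
now). The DATED RUNGS of the cell
(U-1 `m3_upper_S3_bdstripseam_W4`, U-2 `m3_upper_S4_plaqseam_W4`, U-3 `m3_upper_S1_bdstrip_W6`, U-4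
`m3_upper_E1_depth2_U8_n7o8`,
L-1 `l4_joint_r1_U8_n7o8_tp0_lower`, L-2 `l4_menuxl_U8_n7o8_tp0_lower`, L-6
`op2_ntangent_U8_n_tp0_lower`) are filed after open as
INFORMAL rank-9 support items of this route (signatures set from the certificates' exact rationals
as they print); they are
mileposts toward the two edges, not pieces of the cone, and are docketed as such.

KILL CRITERIA. A certified LOWER row at (8,7/8,0) with lo > −3/4 refutes UpperEdge_le_m3o4 (and the
float literature with it); a certified UPPER
row with hi < −4/5 refutes LowerEdge_ge_m4o5; either closes the route `refuted:<Decl>` and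
re-targets M3′ to a shifted split (new
route, new decls — never a reworded item). A proof that no translation-invariant moment relaxation
of footprint class T2 can pass
−0.80 (a ceiling theorem like cal-3's H5 cap −0.7826 for (≤3,5)) does not refute the crux but kills
the planned producers —
pivot the lower half to a different lever (n-tangent transport from neighbouring densities, G-D
class) or park dormant. If the
operator re-types the window leaf as this conjunction, nothing changes; if as a different split,
`closes` is re-certified or the
route is superseded by the route carrying that split.

NOT DECOMPOSED YET. Which upper object reaches −3/4 (open strips w = 12/16 column-MPS, seam-dressed
32 × 4k tilings with 2-D seam correlations,
PEPS-column states) and its exact-arithmetic certificate format; which lower edition/footprint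
reaches −4/5 (T2-class windows,
rider/word enlargements, the 3-RDM fragment of Hastings2022 §2.2); the split itself is a DESIGN
CONSTANT of this route (declared,
not claimed optimal): the alternative splits [−79/100, −37/50] and [−0.795, −0.745] are other routes
if a producer prices them.
t′ = −1/4 is the companion route M3PrimeEdgeSplitTpm1o4; the ×2.0 leaf is route M3x2OnLower529.

CHEAPEST FALSIFIER. Run by this seat (lean check, rc 0, sorries 0, audit `proof-of-item
closed:true`): the TARGET LEAF AS TYPED is classically
inhabited — `theorem M3Window_tp0_M3prime_vacuous : MbsolverRungLeaves.M3Window_tp0_M3prime` follows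
from `exists_rat_btwn`
alone (folder `Sketch.lean`, namespace `LinesSeatAudit`; likewise `M3Window_tp0_le_1o10`,
`M3Window_tpm1o4_M3prime` and every
`∃ lo hi … ∧ hi − lo ≤ w` leaf). Consequence: `closes` into the leaf is bookkeeping; the CONTENT of
this route is the pair of
threshold cruxes (each ⟺ a one-sided inequality on e, e.g. `upperEdge_iff : UpperEdge_le_m3o4 ↔ e ≤
−3/4`), which are NOT
vacuous; a re-typing of the window leaves as declared-split conjunctions is recommended to the
operator (needs-human). The
cheapest kill of the cruxes themselves is a lookup: is any CERTIFIED row across the split already?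
No — CERTIFIED.md 2026-08-29 (597 rows; re-dated by the lines seat g7):
best upper #580 −0.7249973335 (needs −0.0250027; earlier #550 −0.7225365534, −0.0275), best lower
#529 −0.8295699476 (needs +0.0296; hub-lb E2α
−0.8271953864 is refereed in pub/hub-lb, not a HOME row — would need +0.0272); float e = −0.767 ±
0.004 lies
inside [−0.80, −0.75] with margins 0.033/0.017.

NUMBERS. Split [−4/5, −3/4], width 1/20 = M3Width. Cell of record (CERTIFIED.md, tree): lower #529
−1002888528743611882756433/2⁸⁰ =
−0.8295699476 (`Certificates.cert_r529_HYB_…_focert_it2000`, `m3_tp0_lower_r529_of`); upper #580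
S5-final multi-layer column-seam W = 4
`COL3ALTR_balW4D1400x0` −25508575947185/2⁴⁵ = −0.7249973335 (node ROW theorem
`m3_tp0_upper_colseam_COL3ALTR_balW4D1400x0_of` from the open claim node
`cert_colseam_COL3ALTR_balW4D1400x0_allmk`; aside M3UpperS5ColseamW4 = stmt-Ventures-22798;
CERTIFIED 2026-08-28T16:53Z, sr-mbsolver-ref-12 g31 R12.29, MOVE 176;
two-sided with #529 by name `m3_tp0_row_r529_colseam_COL3ALTR_balW4D1400x0_of` / `_width`; the
window leaf `M3Window_tp0_le_1o8` re-closed from it is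
bookkeeping, not rung progress), supersedes #550 S4 plaquette-seam W = 4 −25421994941063/2⁴⁵ =
−0.7225365534 (node `m3_tp0_upper_plaqseam_plaqW4D1400_x01_of`;
aside M3UpperS4PlaqseamW4) by 43290503061/2⁴⁴ = 0.0024607801 and #524 RS −12525490015723/2⁴⁴ =
−0.7119916754; width [#529, #580] =
126420533058077496662353/2⁸⁰ = 0.1045726140 = ×2.09 of 1/20 (midpoint −0.7773, width = 13.45 % of
|mid|; refreshed 2026-08-29 by the lines seat g7 — was
×2.14 with #550 (g5, 2026-08-28) and ×2.35 with #524 at birth). Distances: upper edge needs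
−0.0250026665 more (879703119439/2⁴⁵), lower edge
+0.0295699476 (#529). Dated objects
(LEAD (E5), floats labelled): S3 seam W = 4 −0.7165560356 (cert, ref-12 docket), S4 plaq-seam W = 4
−0.7225371717 FLOAT, open-strip
MODEL float ladder w = 4/6/8: −0.726 / −0.734…−0.739 / −0.742…−0.746 (infinite open strips, e_TL +
0.165/w, TILING-CEILING v0.3) versus the producers'
seamed TI cells: W = 6 banked ≥ −0.716 FLOAT, dressed ≈ −0.7205 ± 0.002 [EST] (eng-2 g9 l.31010), W
= 8 dressed ≈ −0.71…−0.73 at bookable cuts, −0.72…−0.74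
at D → ∞ [EST] (var-1 l.30374, eng-1 g13 l.30136); lineage-1 ceiling −0.71…−0.72 FLOAT;
lower forecast L-1 joint edition E₁ + [2.5e-4, 3.5e-3]; footprint-(≤3,5) cap −0.7826 (cal-3 CEILING
H5). Float TL references:
e(1,0,8,7/8) = −0.767 ± 0.004 (ZhengEtAl2017: AFQMC −0.7668(2), DMRG −0.7627(5), DMET −0.77063,
iPEPS −0.7673(20)); printed SDP
lower K = 7 −0.867 (Han2020Bootstrap Tab. e2). Registered neighbours: T1 leaves −167/200 (met by
#529, cert-hypothesis) and −4/5
(this route's lower crux); R2c leaves −0.7119916754 (RS, met by #524) and −18/25 (route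
R2cOpenStripTangentLine). NAMED THRESHOLDS «PS-EXCLUSION (8,⅞,0)» (director-hubbard g14, mbsolver
INBOX l.29033; hubbard-box-p1 g17 WHAT A NUMBER BUYS l.29031, MOTT-KERNEL-TABLE-g17.md
4316fad732ba8a7d §(c), law `IsTranslationInvariant.energyDensityTT'_lt_meanEnergy_mix_of_strict_at`
/ pattern `mottC_…_not_groundState_mix`; LEAD (E51) l.29037 re-read by value): the competing-order
sentence «no macroscopic phase separation of the ⅛-hole-doped ground state (U = 8, t′ = 0) into n =
n₁ | n = 1 regions» is a kernel theorem as soon as u(8,⅞,0) < the chord through 7/8 of the certified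
LOWERS at n₁ and 1. Pair (½ | 1): ¼·lo#576(8,½,0) + ¾·lo#428(8,1,0) = −0.6899999678 already lies
ABOVE upper #550 −0.7225365533 by +0.0325365856 (three signed rows #550 ∧ #576 ∧ #428; it was
0.0145728 short with the superseded #545 −1.2859425, the figure in l.29033) ⇒ CROSSED 2026-08-28,
the theorem is box-p1's to land; the director's UPPER door < −0.7371094 for this pair is moot. Pair
(⅝ | 1) = the NEXT threshold in reach: (8,⅞,0) UPPER < ⅓·lo#574(8,⅝,0) + ⅔·lo#428 = −0.7388205 —
0.0163 below #550, 0.0138 below S5-final, and 0.0112 INSIDE this route's upper crux (−3/4 <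
−0.7388205), so every producer object priced for UpperEdge_le_m3o4 crosses it on the way (the H11
dressed-strip forecast −0.745 ± 0.01 would; S5 −0.7250 does not) and buys two ladder words at once
(TARGET UPPER MOVE + the D-0096 (iii) sentence) — or (8,⅝,0) LOWER > −1.0592797 (today #574
−1.1081316) or (8,1,0) LOWER > −0.5297390 (today #428 −0.5541650). Pairs (¾ | 1), (⅘ | 1): out of
reach of uppers alone (< −0.7819597 / −0.8000827, below the AFQMC float −0.766) — lower-side objects
only. Recorded as named mileposts of the attacked conjunct, NOT items of this route (different
sentences, box-p1's law and desk; each threshold moves when a neighbouring lower moves).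

DEFINITION REQUESTS. None: `M3EnergyUpperRow/LowerRow/Row`, `M3Width`, the rung leaves,
`energyDensityTT'`, the tiling and torus transports all exist.

Novelty: Searches (2026-08-27): `lit search --hybrid "rigorous certified two-sided bounds ground state energy
doped Hubbard model
thermodynamic limit semidefinite" -n 8` (8 docs: Essler2005, Gubernatis2016, arXiv:2511.20860 defect
bootstrap, arXiv:1910.08931 —
none a certified doped 2-D TL window); `lit galaxy search "bootstrap|Hubbard model|lower bound"
--star all -n 10` (30 rows, 0
relevant, substring noise); `lit galaxy search "bootstrapping the Hubbard|many-body
bootstrap|certified lower bound on the ground"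
--star pdf` (1 hit: arXiv:2507.02386 bootstrapping periodic quantum systems — float bootstrap, no
rounding); tree: `lean search
--decl energyDensityTT'_ge_of_window_certificate` (2 soundness theorems landed), `ledger route
closers --problem Ventures` (leaf
registered, rung M3w).
Nearest prior art found: Han2020Bootstrap (arXiv:2006.06002, K = 7 float SDP lower −0.867 at this
point), WangEtAl2024
(arXiv:2310.05844, certified SDP two-sided windows for spin systems), the programme's own rows
#529/#524 and route
R2cOpenStripTangentLine (−18/25 upper leaf).
Delta: the first typed statement of M3′ as a DECIDED object — a declared split whose two halves are
one-sided certified TL rows —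
rather than a window-existence sentence; mathematically a registration (crew rung route), not a new
mechanism.
Claimed grade: known  [refs: 2511.20860, 1910.08931, 2507.02386, 2006.06002, 2310.05844, WangEtAl2024]

Barriers (technique_class: certified-upper-bound, sdp-lower-bound, cluster-tiling): - technique_class: certified-upper-bound, sdp-lower-bound, cluster-tiling
- Literature.Barriers.HubbardSuperconductivity.SignProblemNPHard: outside its class — neither edge
samples; the upper certificate is an explicit state with an exactly evaluated Rayleigh quotient, the
lower an exact rational dual functional checked in interval arithmetic; NP-hardness of generic
sign-free QMC does not quantify over either.
- Literature.Barriers.HubbardSuperconductivity.DegreeFourSosMissesSecondOrderPerturbation: INSIDE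
its class for LowerEdge_ge_m4o5 — a degree-4 (2-RDM-level) relaxation cannot be asymptotically
exact; the crux does not need exactness, it needs −0.80 at U = 8 (0.033 below e), and the cell's
relaxations already carry degree-6 fragments (plaquette/rider words); the bet is that a T2-class
footprint passes −0.80 before the size wall.
- Literature.Barriers.HubbardSuperconductivity.PureModelStripeCompetition: does not bite validity
(energies, not order); it prices the UPPER crux: stripe/uniform near-degeneracy ≈ 0.01t at (8, 1/8)
sits inside the 0.017 margin only just — the certified state must be stripe-aware (period-8/16
supercells).
- Literature.Barriers.HubbardSuperconductivity.EnergyWindowCeilingResolution: not applicable — no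
observable ceiling is claimed; conversely this route's window is exactly the slack G that barrier
says OBS routes inherit (0.05·t).
- Literature.Barriers.HubbardSuperconductivity.OrderParameterInvisibleToGroundStateConstraints:
conceded and irrelevan

History (route lifecycle, newest last):
- 2026-08-28T06:23:10Z · closes_target -> closes rung M3w of Ventures/CertifiedManyBodySolver: Summit.Ventures.CertifiedManyBodySolver.MbsolverRungLeaves.M3Split_tp0_M3prime (D-0061; not the summit Statement) (planner-hubbard-m3-lines-1-g3-0)
- 2026-08-28T06:23:43Z · closes_target -> closes rung M3w of Ventures/CertifiedManyBodySolver: Summit.Ventures.CertifiedManyBodySolver.MbsolverRungLeaves.M3Split_tp0_M3prime (D-0061; not the summit Statement) (planner-hubbard-m3-lines-1-g3-0)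
- 2026-08-28T06:24:33Z · closes_target -> closes rung M3w of Ventures/CertifiedManyBodySolver: Summit.Ventures.CertifiedManyBodySolver.MbsolverRungLeaves.M3Split_tp0_M3prime (D-0061; not the summit Statement) (planner-hubbard-m3-lines-1-g3-0)
- 2026-08-28T06:26:16Z · closes_target -> closes rung M3w of Ventures/CertifiedManyBodySolver: Summit.Ventures.CertifiedManyBodySolver.MbsolverRungLeaves.M3Split_tp0_M3prime (D-0061; not the summit Statement) (planner-hubbard-m3-lines-1-g3-0)
- 2026-08-28T06:27:24Z · closes_target -> closes rung M3w of Ventures/CertifiedManyBodySolver: Summit.Ventures.CertifiedManyBodySolver.MbsolverRungLeaves.M3Split_tp0_M3prime (D-0061; not the summit Statement) (planner-hubbard-m3-lines-1-g3-0)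
- 2026-08-28T06:32:23Z · closes_target -> closes rung M3w of Ventures/CertifiedManyBodySolver: Summit.Ventures.CertifiedManyBodySolver.MbsolverRungLeaves.M3Split_tp0_M3prime (D-0061; not the summit Statement) (planner-hubbard-m3-lines-1-g3-0)
- 2026-08-28T21:26:26Z · rev 14: informal re-worded for M3UpperS1BdstripW6 (planner-hubbard-m3-lines-1-g6-0)
- 2026-08-29T00:27:45Z · rev 15: informal re-worded for M3UpperS1BdstripW6 (planner-hubbard-m3-lines-1-g6-0)

sub-problem: CertifiedManyBodySolver · status: open · opened planner-hubbard-m3-lines-1-g0-0 2026-08-27T20:20:31Z · rev 16 · ledger route-Ventures-M3PrimeEdgeSplit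
GENERATED by the gate from the ledger (D-0016/17). Provers cite these decls: `theorem foo : Summit.Ventures.CertifiedManyBodySolver.Theses.M3PrimeEdgeSplit.<Decl> := …` in Summits/Ventures/CertifiedManyBodySolver/Theorems/<Name>.lean.
-/

namespace Summit.Ventures.CertifiedManyBodySolver.Theses.M3PrimeEdgeSplit

open scoped BigOperators Topology Manifold Classical MeasureTheory ProbabilityTheory Matrix InnerProductSpace ComplexConjugate ContinuousMap
open Filter Set Function TopologicalSpace MeasureTheory

-- H21.Audit: Ventures rung route — no summit Statement decl; the expected conclusion is the closer leaf tagged below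
attribute [summit_statement] _root_.Summit.Ventures.CertifiedManyBodySolver.MbsolverRungLeaves.M3Split_tp0_M3prime

/-- item stmt-Ventures-21720 · crux · rank 2 · open · by planner
why it might fail: −3/4 sits only 0.017 above the float TL (−0.767±0.004, ZhengEtAl2017); open strips lose ≈0.165/w per site (w=8: −0.744 FLOAT), so w ≥ 12–16 or 2-D seam-correlated states at certifiable bond dimension are needed; false outright if e(1,0,8,7/8) > −0.75.
sources: ZhengEtAl2017, LeBlancEtAl2015, QinEtAl2020, Ruelle1969
[crux] some certified thermodynamic-limit UPPER row at (8, 7/8, 0) at or below −3/4: ∃ hi ∈ ℚ, hi ≤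
−3/4 ∧ e(1,0,8,7/8) ≤ hi (equivalently e ≤ −3/4). Producers (LEAD (E5) U-1…U-5): S3 bd-strip-seam W
= 4 (−0.7165560356, cert), S4 plaquette-seam W = 4 (−0.7225 FLOAT), S1 bd-strip W = 6 column (no
number), E1 depth-2 dressed quasi-free, D8/D78 plane programme — none reaches −3/4; the object that
does is a w ≥ 12 open strip / 2-D seam-correlated state at certifiable bond dimension. [difficulty:
XL] -/
@[route_item "route-Ventures-M3PrimeEdgeSplit"]
def UpperEdge_le_m3o4 : Prop :=
  ∃ hi : ℚ, hi ≤ (-3/4 : ℚ) ∧ Summit.Ventures.CertifiedManyBodySolver.M3EnergyUpperRow 0 hi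

/-- item stmt-Ventures-21721 · crux · rank 3 · open · by planner
why it might fail: needs +0.0296 over the lower of record #529 (−0.8296, 1.7M-multiplier FO dual); every +0.01 costs ≈×10 in relaxation size, degree-4 SOS misses 2nd-order PT (Hastings2022) and footprint-(≤3,5) windows cap at −0.7826 (cal-3 H5); false if e < −0.8.
sources: Han2020Bootstrap, Hastings2022, WangEtAl2024, ZhengEtAl2017
[crux] some certified thermodynamic-limit LOWER row at (8, 7/8, 0) at or above −4/5: ∃ lo ∈ ℚ, −4/5
≤ lo ∧ lo ≤ e(1,0,8,7/8) — BY NAME the registered T1 PROGRAMME leaf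
`MbsolverRungLeaves.M3Lower_tp0_ge_m4o5` (alt-closer rung T1; any theorem proving that leaf closes
this item by `exact`). Producers (LEAD (E5) / seat A l.26029 L-1, L-2, L-6): JOINT MENU ⊕ rider96 ⊕
PLQ3s800 first-order dual editions (expected +2.5e-4…+3.5e-3 over #529), MENU-XL (conditional),
n-tangent derived lowers; needs a T2-class footprint to pass −0.80. [difficulty: XL] -/
@[route_item "route-Ventures-M3PrimeEdgeSplit"]
def LowerEdge_ge_m4o5 : Prop :=
  Summit.Ventures.CertifiedManyBodySolver.MbsolverRungLeaves.M3Lower_tp0_ge_m4o5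

/-- item stmt-Ventures-22472 · aside · rank 9 · open · by planner
[support][rung U-1] M3EnergyUpperRow 0 q, q = the exact rational of the S3 boundary-strip SEAM-v1 W
= 4 certificate (float -0.7165560356; shape: exists hi <= q with energyDensityTT' 1 0 8 (7/8) <= hi,
via Upper.DressedBoxTiling.energyDensityTT'_le_of_tiling_rat from an all-k open-strip family);
milepost toward crux UpperEdge_le_m3o4 (does NOT reach -3/4: rungs are rungs); lanes
hubbard-upper-eng-1 g9 / var-1 g23 (cert + p16 twin VERIFY PASS l.25845), referee ref-12; signature
to be set from the certificate file when lit-4 prints the exact rational. Why it might fail: only a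
replay/format defect (the bound itself is variational). Sources: mbsolver INBOX l.26043 (E5)(b),
CERTIFIED.md seam-v1 row. -/
@[route_item "route-Ventures-M3PrimeEdgeSplit"]
def M3UpperS3BdstripseamW4 : Prop :=
  ∃ hi : ℚ, hi ≤ (-3151446772679/4398046511104 : ℚ) ∧ Summit.Ventures.CertifiedManyBodySolver.M3EnergyUpperRow 0 hi

/-- item stmt-Ventures-22478 · aside · rank 9 · open · by planner
[support][rung U-2] M3EnergyUpperRow 0 q, q = the S4 PLAQ-SEAM W = 4 certificate value (FLOAT today
-0.7225371717, cert legs to be named by eng-1 g9); same transport shape as U-1; milepost toward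
UpperEdge_le_m3o4 and, iff q <= -18/25, ALSO a line on route-Ventures-R2cOpenStripTangentLine (an
all-k family at 7/8 with endpoint <= -18/25 discharges both R2c cruxes via
Theorems.bothFamiliesBelowLine_of_allk_sevenEighths) — file the proof there, not as a new route. Why
it might fail: the float may not survive exact certification at the stated digits; -18/25 needs
+0.0025 beyond it. Sources: l.26043 (E5)(b) U-2; R2cOpenStripTangentLine.lean. -/
@[route_item "route-Ventures-M3PrimeEdgeSplit"]
def M3UpperS4PlaqseamW4 : Prop :=
  ∃ hi : ℚ, hi ≤ (-25421994941063/35184372088832 : ℚ) ∧ Summit.Ventures.CertifiedManyBodySolver.M3EnergyUpperRow 0 hi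

/-- item stmt-Ventures-22479 · aside · rank 9 · open · by planner
[support][aside][rung U-3 / W6-A = FIRST W = 6 instance of record] M3EnergyUpperRow 0 q, q =
−835760963/1200000000 = −0.69646746916̅ (= the SIGNED cell claim c_cell = −835760963/25000000 per
48-site W = 6 period, per site; print −0.6964674692): the W6-A CELL CERT = first instance of the S1
boundary-dressed open-strip COLUMN family (bare a = ∞ W = 6 strip cell 02e0f33b…, D 1600; producer
var-2 kit j308772, eng-1 g12 READ PASS l.28948; referee sr-mbsolver-ref-12 g33 R12.34 engine twin
PASS (kit j317968) + R12.33 plaquette-dressed (B′) companion on the same tensor E/site ≤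
−0.7057268635929758; mbsolver INBOX l.29815 / l.29823). SUPERSEDED BY VALUE inside the same class
the same night by the W6-B pair (cell c2d7eb11, eng-2 D 1600 FLOOR tensor): cell claim
−67786647/2000000 per cell = −0.70611090625/site (R12.35, l.30052) and seam-dressed E/site ≤
−0.7140077335 (R12.36, l.30155) — referee-confirmed, NOT rows, hence NOT typed as items («typing
follows a row»); this decl keeps the first-instance literal (a filed signature is never re-valued in
place). NOT a CERTIFIED row (row bar −864/25 per cell = −0.72/site not met by any W = 6 object
tonight; best −0.7140 is 1.10e-2 above #580); format -/
@[route_item "route-Ventures-M3PrimeEdgeSplit"]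
def M3UpperS1BdstripW6 : Prop :=
  ∃ hi : ℚ, hi ≤ (-835760963/1200000000 : ℚ) ∧ Summit.Ventures.CertifiedManyBodySolver.M3EnergyUpperRow 0 hi

-- item stmt-Ventures-22480 · support · rank 9 · open · by planner — informal only, no Lean statement yet:
--   [support][rung U-4] exists omega : InfVolFermionState 2, omega.IsTranslationInvariant and
--   omega.density = 7/8 and omega.hubbardEnergyDensity 1 8 <= E2, E2 = the E1-pipeline DEPTH-2 dressed
--   quasi-free value at (8, 7/8, 0) (STEP0-DEPTH2 j288060 running, no number), giving M3EnergyUpperRow 0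
--   E2 by the variational principle IsTranslationInvariant.energyDensity2D_le_hubbardEnergyDensity +
--   energyDensityTT'_zero (G-U node shape of p556695); milepost toward UpperEdge_le_m3o4. Why it might
--   fail: depth-2 dressing of a quasi-free state at U = 8 is far from -3/4 (Gutzwiller-class energies ~
--   -0.6); it is a

-- item stmt-Ventures-22481 · support · rank 9 · open · by planner — informal only, no Lean statement yet:
--   [support][rung L-1] M3EnergyLowerRow 0 E_J, E_J = the exact certc certificate of the JOINT
--   word-program edition E = MENU + rider96 + PLQ3s800 (first-order dual iterate, END), expected E_J -
--   E_1 in [+2.5e-4, +3.5e-3] [EST] over #529 E_1 = -1002888528743611882756433/2^80 (the (E4)-trigger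
--   object); milepost toward crux LowerEdge_ge_m4o5 (= leaf M3Lower_tp0_ge_m4o5, needs +0.0296) and
--   toward leaf M3Lower_tp0_ge_m0835 (needs -0.835 <= E_J: NOT expected from this edition). Why it might
--   fail: FO dual iterate may stall below +2.5e-4; certificate replay (readers A/B, G2 op-03) may
--   MISMATCH. Sources: mb

-- item stmt-Ventures-22482 · support · rank 9 · open · by planner — informal only, no Lean statement yet:
--   [support][rung L-2, CONDITIONAL] M3EnergyLowerRow 0 E_XL for a ~5x MENU edition selected by the
--   tooth map (XLPROBE-0); born as a task only if the MENU-XL SCOUT prints delta_XL(4000) >= +3.0e-3;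
--   milepost toward LowerEdge_ge_m4o5. Why it might fail: the scout may print < +3.0e-3 (then this item
--   is moot); degree/footprint of MENU-class relaxations is capped near -0.78 (cal-3 CEILING H5) so it
--   cannot be the closer of -4/5 by itself. Sources: l.26029 (L-2); l.26043 (E5)(b); Han2020Bootstrap;
--   Hastings2022.

-- item stmt-Ventures-22483 · support · rank 9 · open · by planner — informal only, no Lean statement yet:
--   [support][rung L-6, DERIVED family] M3EnergyLowerRow 0 (a + b*(7/8)) DERIVED from two SIGNED density
--   rows e0(8, n1, 0) >= r1, e0(8, n2, 0) >= r2 at neighbouring densities (L-4 cell (8,4/5,0): exact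
--   -5728091335723996361405341/(5*2^80); L-5 cell (8,3/4,0): E_DT(3/4), float ~ -1.00975) by the
--   n-tangent arithmetic of op-02 (files ..._lower_derived_ntangent536_row541.lean; G-D class); a
--   consistency rung for LowerEdge_ge_m4o5, never its closer (tangent extrapolation to 7/8 amplifies the
--   neighbours deficits x2.5: today ~ -1.07). Why it might fail: it cannot beat the direct row #529
--   unless the neighbo

/-- item stmt-Ventures-22798 · aside · rank 9 · open · by planner
sources: mbsolver INBOX l.28935 (CERTIFICATE PASS), mbsolver INBOX l.29207 / REFEREE.md R12.29, CERTIFIED.md #580, ZhengEtAl2017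
[support][aside][rung U-5 / S5-final] M3EnergyUpperRow 0 q, q = −25508575947185/2⁴⁵ =
−0.72499733355428… (⌈exact·2⁴⁵⌉/2⁴⁵ of R12.29 exact −0.7249973335543…, the #550-grammar dyadic;
10-dp outward print −0.7249973335; literal − exact 2.7e-14 ≥ 0), the ROW LITERAL of record of
CERTIFIED #580 = the BD-STRIP S5 COLUMN-SEAM (`bd-strip-colseam-v1`) W = 4 EXACT-CERT at (8,7/8,0)
(object COL3ALTR@BAL: a = ∞ W = 4 BAL-twin glide cell + 8 exact rational 2×2 plaquette gates + 16
three-site column gates per 64-site period; E_period ≤ -46.3998293474 outward; producer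
hubbard-upper-eng-1 g12 `final` kit j310833, referee sr-mbsolver-ref-12 R12.29, Lean node PENDING at
filing (var-7 w1 / lit-4 g29, (E53)(1)(b)); FORMAT colseam-v1 v0.4 blind re-verification = certfmt-1
g6); same transport shape as U-1/U-2 (Upper.DressedBoxTiling all-k open-cluster family ⇒
energyDensityTT' 1 0 8 (7/8) ≤ q); read-back `∃ hi ≤ q ∧ M3EnergyUpperRow 0 hi` ⇔ e(1,0,8,7/8) ≤ q
(the threshold clause is the content). Milepost toward crux UpperEdge_le_m3o4 (-3/4: MISSED by
879703119439/2⁴⁵ = 0.0250027) and toward route-Ventures-M3x2EdgeSplit crux UpperEdge_le_m73o100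
(-73/100: MISSED by 4400391941559/879609302220800 = 0.0050 -/
@[route_item "route-Ventures-M3PrimeEdgeSplit"]
def M3UpperS5ColseamW4 : Prop :=
  ∃ hi : ℚ, hi ≤ (-25508575947185/35184372088832 : ℚ) ∧ Summit.Ventures.CertifiedManyBodySolver.M3EnergyUpperRow 0 hi

/-- item stmt-Ventures-21722 · assembly · rank 1 · closed · proved by Summit.Ventures.CertifiedManyBodySolver.Theorems.m3PrimeEdgeSplitAssembly_proof (prover) · by planner
sources: Ruelle1969, Han2020Bootstrap
[assembly] UpperEdge_le_m3o4 → LowerEdge_ge_m4o5 → M3Window_tp0_M3prime (the rung leaf: ∃ lo hi,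
M3EnergyRow 0 lo hi ∧ M3Width lo hi). -/
@[route_item "route-Ventures-M3PrimeEdgeSplit"]
def Assembly : Prop :=
  UpperEdge_le_m3o4 → LowerEdge_ge_m4o5 → Summit.Ventures.CertifiedManyBodySolver.MbsolverRungLeaves.M3Window_tp0_M3prime

-- `Assembly` holds: proved by `Summit.Ventures.CertifiedManyBodySolver.Theorems.m3PrimeEdgeSplitAssembly_proof` (its module imports this route file, so no `_holds` link can be stated here).

/-! D-0027 §2.1 — DECIDING THEOREM (planner-authored via `route open/edit --closes-file`; by planner-hubbard-m3-lines-1-g3-0 2026-08-28T06:32:23Z):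
its hypotheses are this route's items and its conclusion the registered leaf `Summit.Ventures.CertifiedManyBodySolver.MbsolverRungLeaves.M3Split_tp0_M3prime` (rung M3w, D-0061) (glue_lint), and it elaborates with this file. -/

@[closes "route-Ventures-M3PrimeEdgeSplit"] theorem closes (h₂ : UpperEdge_le_m3o4) (h₃ : LowerEdge_ge_m4o5) :
    Summit.Ventures.CertifiedManyBodySolver.MbsolverRungLeaves.M3Split_tp0_M3prime :=
  ⟨h₃, h₂⟩

end Summit.Ventures.CertifiedManyBodySolver.Theses.M3PrimeEdgeSplit
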